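import Mathlib
import Literature.Analysis.FluidPDE.VectorCalculus
import Literature.Analysis.FluidPDE.VortexFilament.CurlEnergy
import Summits.NavierStokesRegularity.NavierStokesRegularity.Theorems.FilamentSkeletonRssSelectionBoxRJRungStraightSkewTools

/-!
# `FilamentSkeletonRss` · crux `SkeletonJ1G` (stmt-NavierStokesRegularity-27849) · line `near_straight_newton` —
# the Γ-free SLIP LAW of the straight `R_π` skew pair (the two-parameter similarity family), kernel-certified

The strategist's DESIGN LAW (`Cruxes/SkeletonJ1/Lines/near_straight_newton_design.md` §1, planner-cstrat-27413 g2; re-derived by hand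
by the tenure planner g14, `TENURE-MEMO-g14.md` §1) for the straight skew pair in waist units,
`p₀ = (d/2, 0, 0)`, `t₀ = (0, S, C)`, `p₁ = (−d/2, 0, 0)`, `t₁ = (0, −S, C)` (`S = sin θ`, `C = cos θ`, `S² + C² = 1`; filament 1 is the
image of filament 0 under `(x, y, z) ↦ (−x, −y, z)`), equal circulation parameters `γ`, frame `½y − α e₃ × y`:
the SCALED SLIP of the predicate `StraightDatum` of the line — tangential component of the closed-form line Biot–Savart field of the
partner plus the frame drift — is, on BOTH lines,

  `W(s) = (γ/2π) · 2SC·d / (d² + 4S²C²·s²) + s/2 − α·S·d/2`                       (`straightPair_slip_zero/one`)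
        `= (ε/2)·(κ₁/(1 + (s/ε)²) + s/ε − κ₂)`,  `ε = d/(2SC)`, `κ₁ = γ(2SC)²/(π d²)`, `κ₂ = 2αS²C`   (`slip_similarity_form`),

i.e. `|d⃗|² = d² + s² sin²2θ`, `⟪t₁ × d⃗, t₀⟫ = d sin 2θ`, frame part `s/2 − α (d/2) sin θ` — exactly the design law's identities, now
kernel facts for EVERY member of the family (the exact rational S1 datum of `…Theorems.FilamentSkeletonRssSkeletonJ1GStubStraightDatum`
is the member `(S, C, d, γ, α) = (3/5, 4/5, 4/25, 125π/108, 875/432)`).  Also the family's elementary geometry: unit tangents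
(`norm_tangent_of_sq_add_sq`), pairwise separation `≥ |d|` (`straightPair_separation`), tilt `⟪t, e₃⟫ = C`, waist `‖p₀ + s t₀‖² = d²/4 + s²`.
USE: any straight datum for `stub_tangentSkeleton`'s continuation (thin corner `κ₂/κ₁ ≲ 0.05` of the design law) instantiates these
lemmas; the one-variable analysis of `F(u) = κ₁/(1+u²) + u − κ₂` is then all that a new `StraightDatum` witness needs.

Lane ns-filament-19175-p1 g11; `--supports stmt-NavierStokesRegularity-27849`.  Route-independent vector algebra (no `Theses` import);
tools `…Theorems.SelectionBoxRJRung.{inner_vec3, cross_vec3, add_vec3, sub_vec3, smul_vec3, single_two_eq_vec3}`,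
`VortexFilament.norm_sq_toLp_three`.  HONEST FRAMING: bookkeeping for a HYPOTHETICAL filament-skeleton construction on the NEGATIVE side
of a MODEL route; nothing here is a claim about Navier–Stokes regularity or blow-up.
-/

set_option linter.dupNamespace false

noncomputable section

namespace Summit.NavierStokesRegularity.NavierStokesRegularity.Theorems.FilamentSkeletonRssSkeletonJ1GStraightPairSlipLaw

open Set Function Filter MeasureTheory Real
open Literature.Analysis.FluidPDE
open scoped InnerProductSpace Topology BigOperators
open Summit.NavierStokesRegularity.NavierStokesRegularity.Theorems.SelectionBoxRJRung

/-! ### Elementary geometry of the pair -/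

/-- A tangent `(0, S, C)` with `S² + C² = 1` is a unit vector. [folklore] -/
theorem norm_tangent_of_sq_add_sq {S C : ℝ} (hSC : S ^ 2 + C ^ 2 = 1) :
    ‖(WithLp.toLp 2 ![0, S, C] : EuclideanSpace ℝ (Fin 3))‖ = 1 := by
  have h : ‖(WithLp.toLp 2 ![0, S, C] : EuclideanSpace ℝ (Fin 3))‖ ^ 2 = 1 := by
    rw [VortexFilament.norm_sq_toLp_three]; linear_combination hSC
  nlinarith [h, norm_nonneg (WithLp.toLp 2 ![0, S, C] : EuclideanSpace ℝ (Fin 3))]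

/-- Tilt: `⟪(0, S, C), e₃⟫ = C`. [folklore] -/
theorem inner_tangent_single_two (S C : ℝ) :
    ⟪(WithLp.toLp 2 ![0, S, C] : EuclideanSpace ℝ (Fin 3)), EuclideanSpace.single 2 1⟫_ℝ = C := by
  rw [single_two_eq_vec3, inner_vec3]; ring

/-- Waist: `‖p₀ + s t₀‖² = d²/4 + s²` for `p₀ = (d/2, 0, 0)`, unit `t₀ = (0, S, C)`. [folklore] -/
theorem norm_sq_point_zero {S C : ℝ} (hSC : S ^ 2 + C ^ 2 = 1) (d s : ℝ) :
    ‖(WithLp.toLp 2 ![d / 2, 0, 0] : EuclideanSpace ℝ (Fin 3)) + s • WithLp.toLp 2 ![0, S, C]‖ ^ 2 = d ^ 2 / 4 + s ^ 2 := by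
  rw [smul_vec3, add_vec3, VortexFilament.norm_sq_toLp_three]; linear_combination (s ^ 2) * hSC

/-- Waist on the image line: `‖p₁ + s t₁‖² = d²/4 + s²`. [folklore] -/
theorem norm_sq_point_one {S C : ℝ} (hSC : S ^ 2 + C ^ 2 = 1) (d s : ℝ) :
    ‖(WithLp.toLp 2 ![-(d / 2), 0, 0] : EuclideanSpace ℝ (Fin 3)) + s • WithLp.toLp 2 ![0, -S, C]‖ ^ 2 = d ^ 2 / 4 + s ^ 2 := by
  rw [smul_vec3, add_vec3, VortexFilament.norm_sq_toLp_three]; linear_combination (s ^ 2) * hSC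

/-- SEPARATION: any point of line 0 and any point of line 1 are at distance `≥ |d|` (their `e₁`-coordinates differ by `d`).
[folklore] -/
theorem straightPair_separation (S C d τ σ : ℝ) :
    |d| ≤ ‖((WithLp.toLp 2 ![d / 2, 0, 0] : EuclideanSpace ℝ (Fin 3)) + τ • WithLp.toLp 2 ![0, S, C]) -
      ((WithLp.toLp 2 ![-(d / 2), 0, 0] : EuclideanSpace ℝ (Fin 3)) + σ • WithLp.toLp 2 ![0, -S, C])‖ := by
  have hsq : |d| ^ 2 ≤ ‖((WithLp.toLp 2 ![d / 2, 0, 0] : EuclideanSpace ℝ (Fin 3)) + τ • WithLp.toLp 2 ![0, S, C]) -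
      ((WithLp.toLp 2 ![-(d / 2), 0, 0] : EuclideanSpace ℝ (Fin 3)) + σ • WithLp.toLp 2 ![0, -S, C])‖ ^ 2 := by
    rw [smul_vec3, smul_vec3, add_vec3, add_vec3, sub_vec3, VortexFilament.norm_sq_toLp_three, sq_abs]
    nlinarith [sq_nonneg (τ * S + σ * S), sq_nonneg (τ * C - σ * C)]
  have hn := norm_nonneg (((WithLp.toLp 2 ![d / 2, 0, 0] : EuclideanSpace ℝ (Fin 3)) + τ • WithLp.toLp 2 ![0, S, C]) -
      ((WithLp.toLp 2 ![-(d / 2), 0, 0] : EuclideanSpace ℝ (Fin 3)) + σ • WithLp.toLp 2 ![0, -S, C]))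
  by_contra h
  rw [not_le] at h
  nlinarith [hsq, mul_pos (sub_pos.2 h) (add_pos_of_pos_of_nonneg (lt_of_le_of_lt hn h) hn)]

/-! ### The slip law on each line -/

/-- **SLIP LAW ON LINE 0.**  `x = p₀ + s t₀`, partner `(p₁, t₁)`, `D = (x − p₁) − ⟪x − p₁, t₁⟫ t₁`:
`⟪(γ/2π)·(‖D‖²)⁻¹·(t₁ × D) + ½x − α e₃ × x, t₀⟫ = (γ/2π)·2SCd/(d² + 4S²C²s²) + s/2 − α·Sd/2` (for `S² + C² = 1`, `d ≠ 0`;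
intermediate identities: `⟪x − p₁, t₁⟫ = s(C² − S²)`, `‖D‖² = d² + 4S²C²s²`, `⟪t₁ × D, t₀⟫ = 2SCd`, `⟪x, t₀⟫ = s`,
`⟪e₃ × x, t₀⟫ = Sd/2`). [folklore] -/
theorem straightPair_slip_zero {S C : ℝ} (hSC : S ^ 2 + C ^ 2 = 1) {d : ℝ} (hd : d ≠ 0) (γ α s : ℝ) :
    ⟪(γ / (2 * Real.pi)) •
        ((‖((WithLp.toLp 2 ![d / 2, 0, 0] : EuclideanSpace ℝ (Fin 3)) + s • WithLp.toLp 2 ![0, S, C]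
              - WithLp.toLp 2 ![-(d / 2), 0, 0]) -
            ⟪(WithLp.toLp 2 ![d / 2, 0, 0] : EuclideanSpace ℝ (Fin 3)) + s • WithLp.toLp 2 ![0, S, C]
                - WithLp.toLp 2 ![-(d / 2), 0, 0], (WithLp.toLp 2 ![0, -S, C] : EuclideanSpace ℝ (Fin 3))⟫_ℝ •
              (WithLp.toLp 2 ![0, -S, C] : EuclideanSpace ℝ (Fin 3))‖ ^ 2)⁻¹ •
          cross (WithLp.toLp 2 ![0, -S, C])
            (((WithLp.toLp 2 ![d / 2, 0, 0] : EuclideanSpace ℝ (Fin 3)) + s • WithLp.toLp 2 ![0, S, C]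
                - WithLp.toLp 2 ![-(d / 2), 0, 0]) -
              ⟪(WithLp.toLp 2 ![d / 2, 0, 0] : EuclideanSpace ℝ (Fin 3)) + s • WithLp.toLp 2 ![0, S, C]
                  - WithLp.toLp 2 ![-(d / 2), 0, 0], (WithLp.toLp 2 ![0, -S, C] : EuclideanSpace ℝ (Fin 3))⟫_ℝ •
                (WithLp.toLp 2 ![0, -S, C] : EuclideanSpace ℝ (Fin 3)))) +
        (1 / 2 : ℝ) • ((WithLp.toLp 2 ![d / 2, 0, 0] : EuclideanSpace ℝ (Fin 3)) + s • WithLp.toLp 2 ![0, S, C]) -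
        α • cross (EuclideanSpace.single 2 1)
          ((WithLp.toLp 2 ![d / 2, 0, 0] : EuclideanSpace ℝ (Fin 3)) + s • WithLp.toLp 2 ![0, S, C]),
      (WithLp.toLp 2 ![0, S, C] : EuclideanSpace ℝ (Fin 3))⟫_ℝ
      = γ / (2 * Real.pi) * (2 * S * C * d) / (d ^ 2 + 4 * S ^ 2 * C ^ 2 * s ^ 2) + s / 2 - α * (S * d / 2) := by
  have h1 : ⟪(WithLp.toLp 2 ![d / 2, 0, 0] : EuclideanSpace ℝ (Fin 3)) + s • WithLp.toLp 2 ![0, S, C]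
      - WithLp.toLp 2 ![-(d / 2), 0, 0], (WithLp.toLp 2 ![0, -S, C] : EuclideanSpace ℝ (Fin 3))⟫_ℝ = s * (C ^ 2 - S ^ 2) := by
    rw [smul_vec3, add_vec3, sub_vec3, inner_vec3]; ring
  have h2 : ‖((WithLp.toLp 2 ![d / 2, 0, 0] : EuclideanSpace ℝ (Fin 3)) + s • WithLp.toLp 2 ![0, S, C]
        - WithLp.toLp 2 ![-(d / 2), 0, 0]) - (s * (C ^ 2 - S ^ 2)) • (WithLp.toLp 2 ![0, -S, C] : EuclideanSpace ℝ (Fin 3))‖ ^ 2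
      = d ^ 2 + 4 * S ^ 2 * C ^ 2 * s ^ 2 := by
    rw [smul_vec3, smul_vec3, add_vec3, sub_vec3, sub_vec3, VortexFilament.norm_sq_toLp_three]
    linear_combination (s ^ 2 * ((S ^ 2 - C ^ 2) ^ 2 - (S ^ 2 + C ^ 2))) * hSC
  have h3 : ⟪cross (WithLp.toLp 2 ![0, -S, C])
        (((WithLp.toLp 2 ![d / 2, 0, 0] : EuclideanSpace ℝ (Fin 3)) + s • WithLp.toLp 2 ![0, S, C]
          - WithLp.toLp 2 ![-(d / 2), 0, 0]) - (s * (C ^ 2 - S ^ 2)) • (WithLp.toLp 2 ![0, -S, C] : EuclideanSpace ℝ (Fin 3))),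
      (WithLp.toLp 2 ![0, S, C] : EuclideanSpace ℝ (Fin 3))⟫_ℝ = 2 * S * C * d := by
    rw [smul_vec3, smul_vec3, add_vec3, sub_vec3, sub_vec3, cross_vec3, inner_vec3]; ring
  have h4 : ⟪(WithLp.toLp 2 ![d / 2, 0, 0] : EuclideanSpace ℝ (Fin 3)) + s • WithLp.toLp 2 ![0, S, C],
      (WithLp.toLp 2 ![0, S, C] : EuclideanSpace ℝ (Fin 3))⟫_ℝ = s := by
    rw [smul_vec3, add_vec3, inner_vec3]; linear_combination s * hSC
  have h5 : ⟪cross (EuclideanSpace.single 2 1)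
        ((WithLp.toLp 2 ![d / 2, 0, 0] : EuclideanSpace ℝ (Fin 3)) + s • WithLp.toLp 2 ![0, S, C]),
      (WithLp.toLp 2 ![0, S, C] : EuclideanSpace ℝ (Fin 3))⟫_ℝ = S * d / 2 := by
    rw [single_two_eq_vec3, smul_vec3, add_vec3, cross_vec3, inner_vec3]; ring
  rw [h1, inner_sub_left, inner_add_left, real_inner_smul_left, real_inner_smul_left, real_inner_smul_left,
    real_inner_smul_left, h2, h3, h4, h5]
  have hπ : Real.pi ≠ 0 := Real.pi_ne_zero
  have hd2 : 0 < d ^ 2 := lt_of_le_of_ne (sq_nonneg d) (Ne.symm (pow_ne_zero 2 hd))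
  have hD : (0 : ℝ) < d ^ 2 + 4 * S ^ 2 * C ^ 2 * s ^ 2 := by nlinarith [hd2, sq_nonneg (S * C * s)]
  have hD' := hD.ne'
  field_simp

/-- **SLIP LAW ON LINE 1** (the `R_π` image): `x = p₁ + s t₁`, partner `(p₀, t₀)`; the SAME value
`(γ/2π)·2SCd/(d² + 4S²C²s²) + s/2 − α·Sd/2`. [folklore] -/
theorem straightPair_slip_one {S C : ℝ} (hSC : S ^ 2 + C ^ 2 = 1) {d : ℝ} (hd : d ≠ 0) (γ α s : ℝ) :
    ⟪(γ / (2 * Real.pi)) •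
        ((‖((WithLp.toLp 2 ![-(d / 2), 0, 0] : EuclideanSpace ℝ (Fin 3)) + s • WithLp.toLp 2 ![0, -S, C]
              - WithLp.toLp 2 ![d / 2, 0, 0]) -
            ⟪(WithLp.toLp 2 ![-(d / 2), 0, 0] : EuclideanSpace ℝ (Fin 3)) + s • WithLp.toLp 2 ![0, -S, C]
                - WithLp.toLp 2 ![d / 2, 0, 0], (WithLp.toLp 2 ![0, S, C] : EuclideanSpace ℝ (Fin 3))⟫_ℝ •
              (WithLp.toLp 2 ![0, S, C] : EuclideanSpace ℝ (Fin 3))‖ ^ 2)⁻¹ •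
          cross (WithLp.toLp 2 ![0, S, C])
            (((WithLp.toLp 2 ![-(d / 2), 0, 0] : EuclideanSpace ℝ (Fin 3)) + s • WithLp.toLp 2 ![0, -S, C]
                - WithLp.toLp 2 ![d / 2, 0, 0]) -
              ⟪(WithLp.toLp 2 ![-(d / 2), 0, 0] : EuclideanSpace ℝ (Fin 3)) + s • WithLp.toLp 2 ![0, -S, C]
                  - WithLp.toLp 2 ![d / 2, 0, 0], (WithLp.toLp 2 ![0, S, C] : EuclideanSpace ℝ (Fin 3))⟫_ℝ •
                (WithLp.toLp 2 ![0, S, C] : EuclideanSpace ℝ (Fin 3)))) +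
        (1 / 2 : ℝ) • ((WithLp.toLp 2 ![-(d / 2), 0, 0] : EuclideanSpace ℝ (Fin 3)) + s • WithLp.toLp 2 ![0, -S, C]) -
        α • cross (EuclideanSpace.single 2 1)
          ((WithLp.toLp 2 ![-(d / 2), 0, 0] : EuclideanSpace ℝ (Fin 3)) + s • WithLp.toLp 2 ![0, -S, C]),
      (WithLp.toLp 2 ![0, -S, C] : EuclideanSpace ℝ (Fin 3))⟫_ℝ
      = γ / (2 * Real.pi) * (2 * S * C * d) / (d ^ 2 + 4 * S ^ 2 * C ^ 2 * s ^ 2) + s / 2 - α * (S * d / 2) := by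
  have h1 : ⟪(WithLp.toLp 2 ![-(d / 2), 0, 0] : EuclideanSpace ℝ (Fin 3)) + s • WithLp.toLp 2 ![0, -S, C]
      - WithLp.toLp 2 ![d / 2, 0, 0], (WithLp.toLp 2 ![0, S, C] : EuclideanSpace ℝ (Fin 3))⟫_ℝ = s * (C ^ 2 - S ^ 2) := by
    rw [smul_vec3, add_vec3, sub_vec3, inner_vec3]; ring
  have h2 : ‖((WithLp.toLp 2 ![-(d / 2), 0, 0] : EuclideanSpace ℝ (Fin 3)) + s • WithLp.toLp 2 ![0, -S, C]
        - WithLp.toLp 2 ![d / 2, 0, 0]) - (s * (C ^ 2 - S ^ 2)) • (WithLp.toLp 2 ![0, S, C] : EuclideanSpace ℝ (Fin 3))‖ ^ 2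
      = d ^ 2 + 4 * S ^ 2 * C ^ 2 * s ^ 2 := by
    rw [smul_vec3, smul_vec3, add_vec3, sub_vec3, sub_vec3, VortexFilament.norm_sq_toLp_three]
    linear_combination (s ^ 2 * ((S ^ 2 - C ^ 2) ^ 2 - (S ^ 2 + C ^ 2))) * hSC
  have h3 : ⟪cross (WithLp.toLp 2 ![0, S, C])
        (((WithLp.toLp 2 ![-(d / 2), 0, 0] : EuclideanSpace ℝ (Fin 3)) + s • WithLp.toLp 2 ![0, -S, C]
          - WithLp.toLp 2 ![d / 2, 0, 0]) - (s * (C ^ 2 - S ^ 2)) • (WithLp.toLp 2 ![0, S, C] : EuclideanSpace ℝ (Fin 3))),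
      (WithLp.toLp 2 ![0, -S, C] : EuclideanSpace ℝ (Fin 3))⟫_ℝ = 2 * S * C * d := by
    rw [smul_vec3, smul_vec3, add_vec3, sub_vec3, sub_vec3, cross_vec3, inner_vec3]; ring
  have h4 : ⟪(WithLp.toLp 2 ![-(d / 2), 0, 0] : EuclideanSpace ℝ (Fin 3)) + s • WithLp.toLp 2 ![0, -S, C],
      (WithLp.toLp 2 ![0, -S, C] : EuclideanSpace ℝ (Fin 3))⟫_ℝ = s := by
    rw [smul_vec3, add_vec3, inner_vec3]; linear_combination s * hSC
  have h5 : ⟪cross (EuclideanSpace.single 2 1)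
        ((WithLp.toLp 2 ![-(d / 2), 0, 0] : EuclideanSpace ℝ (Fin 3)) + s • WithLp.toLp 2 ![0, -S, C]),
      (WithLp.toLp 2 ![0, -S, C] : EuclideanSpace ℝ (Fin 3))⟫_ℝ = S * d / 2 := by
    rw [single_two_eq_vec3, smul_vec3, add_vec3, cross_vec3, inner_vec3]; ring
  rw [h1, inner_sub_left, inner_add_left, real_inner_smul_left, real_inner_smul_left, real_inner_smul_left,
    real_inner_smul_left, h2, h3, h4, h5]
  have hπ : Real.pi ≠ 0 := Real.pi_ne_zero
  have hd2 : 0 < d ^ 2 := lt_of_le_of_ne (sq_nonneg d) (Ne.symm (pow_ne_zero 2 hd))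
  have hD : (0 : ℝ) < d ^ 2 + 4 * S ^ 2 * C ^ 2 * s ^ 2 := by nlinarith [hd2, sq_nonneg (S * C * s)]
  have hD' := hD.ne'
  field_simp

/-! ### The similarity (bump) form of the design law -/

/-- **SIMILARITY FORM** (design law §1): with the bump width `ε = d/(2SC)` and `κ₁ = γ(2SC)²/(π d²)`, `κ₂ = 2αS²C`,
`(γ/2π)·2SCd/(d² + 4S²C²s²) + s/2 − α·Sd/2 = (ε/2)·(κ₁/(1 + (s/ε)²) + s/ε − κ₂)` — the whole slip structure of the straight pair
depends on the two numbers `(κ₁, κ₂)`, `ε` being a pure scale (`S, C, d ≠ 0`). [folklore] -/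
theorem slip_similarity_form {S C d : ℝ} (hS : S ≠ 0) (hC : C ≠ 0) (hd : d ≠ 0) (γ α s : ℝ) :
    γ / (2 * Real.pi) * (2 * S * C * d) / (d ^ 2 + 4 * S ^ 2 * C ^ 2 * s ^ 2) + s / 2 - α * (S * d / 2) =
      (d / (2 * S * C)) / 2 *
        ((γ * (2 * S * C) ^ 2 / (Real.pi * d ^ 2)) / (1 + (s / (d / (2 * S * C))) ^ 2) + s / (d / (2 * S * C)) - 2 * α * S ^ 2 * C) := by
  have hπ : Real.pi ≠ 0 := Real.pi_ne_zero
  have hd2 : 0 < d ^ 2 := lt_of_le_of_ne (sq_nonneg d) (Ne.symm (pow_ne_zero 2 hd))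
  have hD : (0 : ℝ) < d ^ 2 + 4 * S ^ 2 * C ^ 2 * s ^ 2 := by nlinarith [hd2, sq_nonneg (S * C * s)]
  have hD' := hD.ne'
  have hSC : 2 * S * C ≠ 0 := by
    have := mul_ne_zero (mul_ne_zero (two_ne_zero) hS) hC; simpa [mul_assoc] using this
  have hE : 1 + (s / (d / (2 * S * C))) ^ 2 ≠ 0 := by positivity
  field_simp
  ring

/-- The ZERO CONDITION in similarity variables: with `u = s/ε = 2SCs/d`, `W(s) = 0 ↔ κ₁/(1+u²) + u − κ₂ = 0` (the bump profile
`F(u) = κ₁/(1+u²) + u − κ₂` of the design law), for `S, C, d > 0`. [folklore] -/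
theorem slip_eq_zero_iff_profile {S C d : ℝ} (hS : 0 < S) (hC : 0 < C) (hd : 0 < d) (γ α s : ℝ) :
    γ / (2 * Real.pi) * (2 * S * C * d) / (d ^ 2 + 4 * S ^ 2 * C ^ 2 * s ^ 2) + s / 2 - α * (S * d / 2) = 0 ↔
      (γ * (2 * S * C) ^ 2 / (Real.pi * d ^ 2)) / (1 + (2 * S * C * s / d) ^ 2) + 2 * S * C * s / d - 2 * α * S ^ 2 * C = 0 := by
  rw [slip_similarity_form hS.ne' hC.ne' hd.ne']
  have hε : 0 < d / (2 * S * C) / 2 := by positivity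
  have hu : s / (d / (2 * S * C)) = 2 * S * C * s / d := by
    field_simp
  rw [hu]
  constructor
  · intro h
    rcases mul_eq_zero.mp h with h | h
    · exact absurd h hε.ne'
    · exact h
  · intro h; rw [h, mul_zero]

end Summit.NavierStokesRegularity.NavierStokesRegularity.Theorems.FilamentSkeletonRssSkeletonJ1GStraightPairSlipLaw
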